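import Summits.BirchSwinnertonDyer.BirchSwinnertonDyer.Theorems.BiquadraticEisensteinDescentHeegnerTwistCouplingInSupplySymbolicMonskyPatternFreeDoor
import HarnessLib

set_option linter.dupNamespace false -- `Summit.BirchSwinnertonDyer.BirchSwinnertonDyer.Theorems.…` (summit = sub)
set_option autoImplicit false

/-!
# Crux `HeegnerTwistCouplingInSupply` (stmt-BirchSwinnertonDyer-21381) — a LOWER BOUND for the number of auxiliary primes of a winning
# Heegner recipe: the diagonal kernel of the base («lopsided bases need more primes»)

Route `BiquadraticEisensteinDescent` (cell `pub/bsd-wall`, width seat `bsd-wall-cm-bed-w3` g21; `--supports` 21381, helper). Engine theorem at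
general `k` in the vocabulary of `…SymbolicMonskyPatternFreeDefs` (`dataK`, `heegnerK`, `AuxCell`).

THE STATEMENT. Let `base : SymbData (k+1)` be the base datum (`P₀ = p`, `P_b = r_b`) and `aux` a list of `t` auxiliary cells passing the
Heegner check `heegnerK base aux` (`K′ = ℚ(√−q₁⋯q_t)`: `∏q ≡ 7 (8)`, `(−∏q/P_b) = +1`). Call `x : Fin (k+1) → 𝔽₂` a DIAGONAL KERNEL VECTOR
of the base when it is supported on the base primes `≡ 1 (mod 4)` and is killed by the Laplacian of the base non-residue digraph
(`∑_{b'} [(P_{b'}/P_b) = −1](x_{b'} + x_b) = 0` for every `b`) — equivalently `(x, x)` lies in the kernel of the base's own Monsky matrix.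
★ `card_add_one_le_length_of_diagKernel`: if Monsky's odd matrix of `(base, aux, pat)` is invertible for SOME mutual pattern `pat`, then every
linearly independent family of diagonal kernel vectors has fewer than `t` members: `#ι + 1 ≤ t`. In words: a winning Heegner recipe — ANY
pattern, ANY classes — needs at least `κ_u + 1` auxiliary primes, `κ_u = dim (ker L ∩ ker D_m)`.

THE MECHANISM (w3 g21 memo PATTERN-FREE-STRUCTURE §3). Pad `x` by zero on the auxiliary indices and put it in BOTH halves: `z = (x̄, x̄)`. By
the row structure (`monskyOddS_mulVec_inl/inr`, w3 g20) and the Heegner column parities (`∑_q [(q/P_b) = −1] = [P_b ≡ 3 (4)]`), `M z` vanishes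
on every base row and equals `η_q(x) := ∑_b [(P_b/q) = −1]·x_b` on BOTH rows of each auxiliary index `q`, with `∑_q η_q(x) = 0`
(`mulVec_padDiag_*`, `sum_eta_eq_zero`). So `x ↦ η(x)` is injective on diagonal kernel vectors when `det M ≠ 0` and lands in the hyperplane
`{∑ = 0}` of `𝔽₂^t`: `#ι ≤ t − 1`. This is the bound that explains the «aligned exceptional class» of w3 g19/g20 (e.g. `p ≡ 3 (8)`, `r ≡ (5,5,5)`,
all `+1`: `κ_u = 3`, so `t ≥ 4` although `t₀ = s*/2+1 = 3`; at `k = 5` the same shape has `κ_u = 5`, `t ≥ 6 = t₀ + 2`).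

HONEST FRAMING: a NECESSARY condition (no recipe is produced); RUNG-LEVEL corner layer (congruent `j = 1728` families); the crux as stated
(C⁺), its registered stubs and BSD are NOT touched; nothing is closed. THEOREMS ONLY (no `def`).
References: [HeathBrown1994] D. R. Heath-Brown, Invent. Math. 118 (1994), appendix by P. Monsky, typescript pp. 39–41; for PATTERNED tails
appended to `2`-Selmer-trivial numbers compare [ReinholzSpearmanYang2018] Funct. Approx. 58 (2018) 69–77, Thm. 1.
-/

namespace Summit.BirchSwinnertonDyer.BirchSwinnertonDyer.Theorems.SymbolicMonsky

open Matrix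

section AuxLowerBound

variable {k : ℕ} (base : SymbData (k + 1)) (aux : List AuxCell) (pat : ℕ → ℕ → Bool)

/-! ## §1 Symbol bookkeeping of `dataK` between base and auxiliary indices -/

/-- Completed symbol of `dataK` on base × base = the base's completed symbol. -/
theorem dataK_neg_castAdd_castAdd (b b' : Fin (k + 1)) :
    (dataK base aux pat).neg (Fin.castAdd aux.length b) (Fin.castAdd aux.length b') = base.neg b b' := by
  unfold SymbData.neg
  rw [RealisesK.dataK_up_castAdd_castAdd, RealisesK.dataK_up_castAdd_castAdd, RealisesK.dataK_cls_castAdd,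
    RealisesK.dataK_cls_castAdd]
  by_cases h : b < b'
  · have h' : Fin.castAdd aux.length b < Fin.castAdd aux.length b' := by
      rw [Fin.lt_def, Fin.val_castAdd, Fin.val_castAdd]; exact Fin.lt_def.mp h
    rw [if_pos h', if_pos h]
  · have h' : ¬ Fin.castAdd aux.length b < Fin.castAdd aux.length b' := by
      rw [Fin.lt_def, Fin.val_castAdd, Fin.val_castAdd]; exact fun hh => h (Fin.lt_def.mpr hh)
    rw [if_neg h', if_neg h]

/-- Completed symbol of `dataK` on base × aux: `[(q_j/P_b) = −1]` = the cell bit. -/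
theorem dataK_neg_castAdd_natAdd (b : Fin (k + 1)) (j : Fin aux.length) :
    (dataK base aux pat).neg (Fin.castAdd aux.length b) (Fin.natAdd (k + 1) j) = (aux.getD j.val (0, 0)).2.testBit b.val := by
  unfold SymbData.neg
  have hlt : Fin.castAdd aux.length b < Fin.natAdd (k + 1) j := by
    rw [Fin.lt_def, Fin.val_castAdd, Fin.val_natAdd]; omega
  rw [if_pos hlt, RealisesK.dataK_up_castAdd_natAdd]

/-- Completed symbol of `dataK` on aux × base: `[(P_b/q_j) = −1]` = cell bit XOR `[P_b ≡ q_j ≡ 3 (4)]` (reciprocity). -/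
theorem dataK_neg_natAdd_castAdd (b : Fin (k + 1)) (j : Fin aux.length) :
    (dataK base aux pat).neg (Fin.natAdd (k + 1) j) (Fin.castAdd aux.length b) =
      xor ((aux.getD j.val (0, 0)).2.testBit b.val)
        (negNegOne (aux.getD j.val (0, 0)).1 && negNegOne (base.cls b)) := by
  unfold SymbData.neg
  have hlt : ¬ Fin.natAdd (k + 1) j < Fin.castAdd aux.length b := by
    rw [Fin.lt_def, Fin.val_castAdd, Fin.val_natAdd]; omega
  rw [if_neg hlt, RealisesK.dataK_up_castAdd_natAdd, RealisesK.dataK_cls_natAdd, RealisesK.dataK_cls_castAdd]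

/-- The Heegner column parity in `𝔽₂`: `∑_j bz [(q_j/P_b) = −1] = bz [P_b ≡ 3 (4)]`. -/
theorem sum_bz_cellBit_eq (hh : heegnerK base aux = true) (b : Fin (k + 1)) :
    (∑ j : Fin aux.length, bz ((aux.getD j.val (0, 0)).2.testBit b.val)) = bz (negNegOne (base.cls b)) := by
  rw [sum_univ_bz, xorFold_aux_eq aux (fun c => c.2.testBit b.val), (heegnerK_spec hh).2.2 b]

/-- Class bookkeeping: `[(2/P)=−1] + [(−2/P)=−1] = [(−1/P)=−1]` in `𝔽₂`. -/
theorem bz_negTwo_add_bz_negNegTwo (a : Fin 4) : bz (negTwo a) + bz (negNegTwo a) = bz (negNegOne a) := by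
  fin_cases a <;> decide

/-! ## §2 The padded diagonal vector and the action of Monsky's matrix on it -/

/-- Base rows, half one: for a diagonal kernel vector `x`, `(M (x̄,x̄))_(inl b) = 0`. -/
theorem mulVec_padDiag_inl_castAdd (hh : heegnerK base aux = true) (x : Fin (k + 1) → ZMod 2)
    (hm : ∀ b, negNegOne (base.cls b) = true → x b = 0)
    (hL : ∀ b, (∑ b' : Fin (k + 1), bz (base.neg b b') * (x b' + x b)) = 0) (b : Fin (k + 1)) :
    ((dataK base aux pat).monskyOddS *ᵥ Sum.elim (Fin.append x (0 : Fin aux.length → ZMod 2))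
        (Fin.append x (0 : Fin aux.length → ZMod 2))) (Sum.inl (Fin.castAdd aux.length b)) = 0 := by
  rw [SymbData.monskyOddS_mulVec_inl]
  simp only [Sum.elim_inl, Sum.elim_inr, Fin.append_left, zmod_two_add_self, mul_zero, add_zero]
  rw [Fin.sum_univ_add]
  simp only [Fin.append_left, Fin.append_right, Pi.zero_apply, zero_add, dataK_neg_castAdd_castAdd,
    dataK_neg_castAdd_natAdd]
  rw [hL b, zero_add, ← Finset.sum_mul, sum_bz_cellBit_eq base aux hh b]
  by_cases hb : negNegOne (base.cls b) = true
  · rw [hm b hb, mul_zero]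
  · have : negNegOne (base.cls b) = false := by simpa using hb
    rw [this]; simp [bz]

/-- Base rows, half two: `(M (x̄,x̄))_(inr b) = 0`. -/
theorem mulVec_padDiag_inr_castAdd (hh : heegnerK base aux = true) (x : Fin (k + 1) → ZMod 2)
    (hL : ∀ b, (∑ b' : Fin (k + 1), bz (base.neg b b') * (x b' + x b)) = 0) (b : Fin (k + 1)) :
    ((dataK base aux pat).monskyOddS *ᵥ Sum.elim (Fin.append x (0 : Fin aux.length → ZMod 2))
        (Fin.append x (0 : Fin aux.length → ZMod 2))) (Sum.inr (Fin.castAdd aux.length b)) = 0 := by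
  rw [SymbData.monskyOddS_mulVec_inr]
  simp only [Sum.elim_inl, Sum.elim_inr, Fin.append_left]
  rw [Fin.sum_univ_add]
  simp only [Fin.append_left, Fin.append_right, Pi.zero_apply, zero_add, dataK_neg_castAdd_castAdd,
    dataK_neg_castAdd_natAdd, RealisesK.dataK_cls_castAdd]
  rw [hL b, zero_add, ← Finset.sum_mul, sum_bz_cellBit_eq base aux hh b]
  -- remaining: bz[2] x_b + bz[−1] x_b + bz[−2] x_b = 0, using bz[2] + bz[−2] = bz[−1] and bz[−1] x_b = 0
  have key : bz (negTwo (base.cls b)) * x b + bz (negNegOne (base.cls b)) * x b + bz (negNegTwo (base.cls b)) * x b =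
      (bz (negNegOne (base.cls b)) + bz (negNegOne (base.cls b))) * x b := by
    rw [← bz_negTwo_add_bz_negNegTwo]; ring
  rw [key, zmod_two_add_self, zero_mul]

/-- Auxiliary rows, half one: `(M (x̄,x̄))_(inl q_j) = η_j(x) := ∑_b bz[(P_b/q_j) = −1]·x_b`. -/
theorem mulVec_padDiag_inl_natAdd (x : Fin (k + 1) → ZMod 2) (j : Fin aux.length) :
    ((dataK base aux pat).monskyOddS *ᵥ Sum.elim (Fin.append x (0 : Fin aux.length → ZMod 2))
        (Fin.append x (0 : Fin aux.length → ZMod 2))) (Sum.inl (Fin.natAdd (k + 1) j)) =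
      ∑ b : Fin (k + 1), bz ((dataK base aux pat).neg (Fin.natAdd (k + 1) j) (Fin.castAdd aux.length b)) * x b := by
  rw [SymbData.monskyOddS_mulVec_inl]
  simp only [Sum.elim_inl, Sum.elim_inr, Fin.append_right, Pi.zero_apply, add_zero, mul_zero]
  rw [Fin.sum_univ_add]
  simp only [Fin.append_left, Fin.append_right, Pi.zero_apply, mul_zero, Finset.sum_const_zero, add_zero]

/-- Auxiliary rows, half two: `(M (x̄,x̄))_(inr q_j) = η_j(x)` as well. -/
theorem mulVec_padDiag_inr_natAdd (x : Fin (k + 1) → ZMod 2) (j : Fin aux.length) :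
    ((dataK base aux pat).monskyOddS *ᵥ Sum.elim (Fin.append x (0 : Fin aux.length → ZMod 2))
        (Fin.append x (0 : Fin aux.length → ZMod 2))) (Sum.inr (Fin.natAdd (k + 1) j)) =
      ∑ b : Fin (k + 1), bz ((dataK base aux pat).neg (Fin.natAdd (k + 1) j) (Fin.castAdd aux.length b)) * x b := by
  rw [SymbData.monskyOddS_mulVec_inr]
  simp only [Sum.elim_inl, Sum.elim_inr, Fin.append_right, Pi.zero_apply, add_zero, mul_zero, zero_add]
  rw [Fin.sum_univ_add]
  simp only [Fin.append_left, Fin.append_right, Pi.zero_apply, mul_zero, Finset.sum_const_zero, add_zero]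

/-- `∑_j η_j(x) = 0` for a vector supported on the base primes `≡ 1 (mod 4)` (Heegner column parity + reciprocity). -/
theorem sum_eta_eq_zero (hh : heegnerK base aux = true) (x : Fin (k + 1) → ZMod 2)
    (hm : ∀ b, negNegOne (base.cls b) = true → x b = 0) :
    (∑ j : Fin aux.length, ∑ b : Fin (k + 1),
        bz ((dataK base aux pat).neg (Fin.natAdd (k + 1) j) (Fin.castAdd aux.length b)) * x b) = 0 := by
  rw [Finset.sum_comm]
  refine Finset.sum_eq_zero fun b _ => ?_
  rw [← Finset.sum_mul]
  by_cases hb : negNegOne (base.cls b) = true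
  · rw [hm b hb, mul_zero]
  · have hb' : negNegOne (base.cls b) = false := by simpa using hb
    simp only [dataK_neg_natAdd_castAdd, hb', Bool.and_false, Bool.xor_false]
    rw [sum_bz_cellBit_eq base aux hh b, hb']
    simp [bz]

/-! ## §3 The lower bound -/

/-- ★ **LOWER BOUND («lopsided bases need more auxiliary primes»).** If the Heegner check holds and Monsky's odd matrix of
`(base, aux, pat)` is invertible for some mutual pattern `pat`, then every linearly independent family of DIAGONAL KERNEL VECTORS of the base
(supported on the base primes `≡ 1 (mod 4)`, killed by the base Laplacian) has fewer than `t = |aux|` members: `#ι + 1 ≤ t`. Equivalently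
`t ≥ κ_u + 1`, `κ_u = dim(ker L ∩ ker D_m)`. Holds for ANY pattern and ANY classes of the auxiliary primes.
[cite: HeathBrown1994SelmerCongruentII, Appendix (Monsky), typescript p. 39 L27–L33] -/
theorem card_add_one_le_length_of_diagKernel (hh : heegnerK base aux = true)
    (hdet : (dataK base aux pat).monskyOddS.det = 1) {ι : Type*} [Fintype ι] (x : ι → Fin (k + 1) → ZMod 2)
    (hm : ∀ i b, negNegOne (base.cls b) = true → x i b = 0)
    (hL : ∀ i b, (∑ b' : Fin (k + 1), bz (base.neg b b') * (x i b' + x i b)) = 0)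
    (hx : LinearIndependent (ZMod 2) x) :
    Fintype.card ι + 1 ≤ aux.length := by
  classical
  set t := aux.length with ht
  set d := dataK base aux pat with hd
  -- the linear map η : 𝔽₂^{k+1} → 𝔽₂^t
  set Nm : Matrix (Fin t) (Fin (k + 1)) (ZMod 2) :=
    Matrix.of fun j b => bz (d.neg (Fin.natAdd (k + 1) j) (Fin.castAdd t b)) with hNm
  set η : (Fin (k + 1) → ZMod 2) →ₗ[ZMod 2] (Fin t → ZMod 2) := Matrix.mulVecLin Nm with hη
  have hη_apply : ∀ (y : Fin (k + 1) → ZMod 2) (j : Fin t),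
      η y j = ∑ b : Fin (k + 1), bz (d.neg (Fin.natAdd (k + 1) j) (Fin.castAdd t b)) * y b := by
    intro y j
    simp [hη, Matrix.mulVec, dotProduct, hNm]
  -- η is injective on diagonal kernel vectors
  have hinj : ∀ y : Fin (k + 1) → ZMod 2, (∀ b, negNegOne (base.cls b) = true → y b = 0) →
      (∀ b, (∑ b' : Fin (k + 1), bz (base.neg b b') * (y b' + y b)) = 0) → η y = 0 → y = 0 := by
    intro y hym hyL hηy
    set z : Fin (k + 1 + t) ⊕ Fin (k + 1 + t) → ZMod 2 :=
      Sum.elim (Fin.append y (0 : Fin t → ZMod 2)) (Fin.append y (0 : Fin t → ZMod 2)) with hz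
    have hMz : d.monskyOddS *ᵥ z = 0 := by
      funext idx
      rcases idx with i | i
      · refine Fin.addCases (fun b => ?_) (fun j => ?_) i
        · exact mulVec_padDiag_inl_castAdd base aux pat hh y hym hyL b
        · rw [Pi.zero_apply, mulVec_padDiag_inl_natAdd base aux pat y j, ← hη_apply y j, hηy, Pi.zero_apply]
      · refine Fin.addCases (fun b => ?_) (fun j => ?_) i
        · exact mulVec_padDiag_inr_castAdd base aux pat hh y hyL b
        · rw [Pi.zero_apply, mulVec_padDiag_inr_natAdd base aux pat y j, ← hη_apply y j, hηy, Pi.zero_apply]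
    have hz0 : z = 0 := by
      by_contra hne
      have : d.monskyOddS.det = 0 := Matrix.exists_mulVec_eq_zero_iff.mp ⟨z, hne, hMz⟩
      rw [hdet] at this
      exact one_ne_zero this
    funext b
    have := congrFun hz0 (Sum.inl (Fin.castAdd t b))
    simpa [hz] using this
  -- the family η ∘ x is linearly independent
  have hηx : LinearIndependent (ZMod 2) (fun i => η (x i)) := by
    rw [linearIndependent_iff'] at hx ⊢
    intro s g hg i hi
    have hsum : η (∑ i ∈ s, g i • x i) = 0 := by
      rw [map_sum]; simpa only [map_smul] using hg
    have hy : (∑ i ∈ s, g i • x i) = 0 := by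
      refine hinj _ (fun b hb => ?_) (fun b => ?_) hsum
      · simp [Finset.sum_apply, Pi.smul_apply, hm _ b hb]
      · have step1 : ∀ b' : Fin (k + 1), bz (base.neg b b') * ((∑ i ∈ s, g i • x i) b' + (∑ i ∈ s, g i • x i) b) =
            ∑ i ∈ s, g i * (bz (base.neg b b') * (x i b' + x i b)) := by
          intro b'
          simp only [Finset.sum_apply, Pi.smul_apply, smul_eq_mul]
          rw [← Finset.sum_add_distrib, Finset.mul_sum]
          exact Finset.sum_congr rfl fun i _ => by ring
        rw [Finset.sum_congr rfl fun b' _ => step1 b', Finset.sum_comm]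
        refine Finset.sum_eq_zero fun i _ => ?_
        rw [← Finset.mul_sum, hL i b, mul_zero]
    exact hx s g hy i hi
  -- it lands in the hyperplane `∑ = 0`
  set φ : (Fin t → ZMod 2) →ₗ[ZMod 2] ZMod 2 := ∑ j : Fin t, LinearMap.proj j with hφ
  have hφ_apply : ∀ v : Fin t → ZMod 2, φ v = ∑ j, v j := by
    intro v; simp [hφ, LinearMap.sum_apply]
  have hmem : ∀ i, η (x i) ∈ LinearMap.ker φ := by
    intro i
    rw [LinearMap.mem_ker, hφ_apply]
    simp only [hη_apply]
    exact sum_eta_eq_zero base aux pat hh (x i) (hm i)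
  -- restrict to the kernel and count dimensions
  have hηx' : LinearIndependent (ZMod 2) (fun i => (⟨η (x i), hmem i⟩ : LinearMap.ker φ)) := by
    apply LinearIndependent.of_comp (LinearMap.ker φ).subtype
    exact hηx
  have hcard := hηx'.fintype_card_le_finrank
  have ht0 : 0 < t := (heegnerK_spec hh).1
  have hlt : LinearMap.ker φ < ⊤ := by
    refine lt_top_iff_ne_top.mpr fun htop => ?_
    have hmem1 : (Pi.single (⟨0, ht0⟩ : Fin t) (1 : ZMod 2)) ∈ LinearMap.ker φ := by rw [htop]; exact Submodule.mem_top
    rw [LinearMap.mem_ker, hφ_apply] at hmem1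
    simp at hmem1
  have hfin : Module.finrank (ZMod 2) (LinearMap.ker φ) < t := by
    have := Submodule.finrank_lt_finrank_of_lt hlt
    simpa [Module.finrank_fintype_fun_eq_card] using this
  omega

/-- The same bound stated for a FINITE SET of diagonal kernel vectors. -/
theorem finsetCard_add_one_le_length_of_diagKernel (hh : heegnerK base aux = true)
    (hdet : (dataK base aux pat).monskyOddS.det = 1) (s : Finset (Fin (k + 1) → ZMod 2))
    (hm : ∀ x ∈ s, ∀ b, negNegOne (base.cls b) = true → x b = 0)
    (hL : ∀ x ∈ s, ∀ b, (∑ b' : Fin (k + 1), bz (base.neg b b') * (x b' + x b)) = 0)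
    (hx : LinearIndependent (ZMod 2) (fun v : s => (v : Fin (k + 1) → ZMod 2))) :
    s.card + 1 ≤ aux.length := by
  classical
  have := card_add_one_le_length_of_diagKernel base aux pat hh hdet
    (fun v : s => (v : Fin (k + 1) → ZMod 2)) (fun v b hb => hm v.1 v.2 b hb) (fun v b => hL v.1 v.2 b) hx
  simpa using this

/-! ## §4 Examples: the aligned exceptional configurations need `t ≥ 4` at `k = 3` and `t ≥ 6` at `k = 5` -/

/-- X₀ (`k = 3`): `p ≡ 3 (8)`, `r ≡ (5,5,5) (8)`, all symbols `+1`. The diagonal kernel contains `e₁, e₂, e₃`, so EVERY winning Heegner recipe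
(any pattern, any classes) has at least `4` auxiliary primes — although `t₀ = s*/2 + 1 = 3` (w3 g19/g20: «t = 3 impossible», found by search). -/
theorem four_le_length_of_X0 (aux : List AuxCell) (pat : ℕ → ℕ → Bool)
    (hh : heegnerK (⟨![1, 2, 2, 2], fun _ _ => false⟩ : SymbData 4) aux = true)
    (hdet : (dataK (⟨![1, 2, 2, 2], fun _ _ => false⟩ : SymbData 4) aux pat).monskyOddS.det = 1) :
    4 ≤ aux.length := by
  have h := card_add_one_le_length_of_diagKernel (⟨![1, 2, 2, 2], fun _ _ => false⟩ : SymbData 4) aux pat hh hdet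
    (![Pi.single 1 1, Pi.single 2 1, Pi.single 3 1] : Fin 3 → Fin 4 → ZMod 2) (by decide) (by decide)
    (Fintype.linearIndependent_iff.mpr (by decide))
  simpa using h

/-- X₀⁽⁵⁾ (`k = 5`): `p ≡ 3 (8)`, five `r ≡ 5 (8)`, all symbols `+1`: every winning Heegner recipe has at least `6` auxiliary primes, two more
than `t₀ = 4` — the first configuration where «t₀ or t₀ + 1» fails (w3 g21 memo §0). -/
theorem six_le_length_of_X0_five (aux : List AuxCell) (pat : ℕ → ℕ → Bool)
    (hh : heegnerK (⟨![1, 2, 2, 2, 2, 2], fun _ _ => false⟩ : SymbData 6) aux = true)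
    (hdet : (dataK (⟨![1, 2, 2, 2, 2, 2], fun _ _ => false⟩ : SymbData 6) aux pat).monskyOddS.det = 1) :
    6 ≤ aux.length := by
  have h := card_add_one_le_length_of_diagKernel (⟨![1, 2, 2, 2, 2, 2], fun _ _ => false⟩ : SymbData 6) aux pat hh hdet
    (![Pi.single 1 1, Pi.single 2 1, Pi.single 3 1, Pi.single 4 1, Pi.single 5 1] : Fin 5 → Fin 6 → ZMod 2)
    (by decide) (by decide) (Fintype.linearIndependent_iff.mpr (by decide))
  simpa using h

end AuxLowerBound

end Summit.BirchSwinnertonDyer.BirchSwinnertonDyer.Theorems.SymbolicMonsky
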